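import Summits.AnomalousDissipation.AnomalousDissipation.Theses.NeutralTaylorWaves
import Summits.AnomalousDissipation.AnomalousDissipation.Theorems.TaylorWaveQuasiSteady.Negative.LoadBearing
import Summits.AnomalousDissipation.AnomalousDissipation.Theorems.TaylorWaveQuasiSteady.Negative.Stretching
import Summits.AnomalousDissipation.AnomalousDissipation.Theorems.TaylorWaveQuasiSteady.Negative.WorkCeiling
import Summits.AnomalousDissipation.AnomalousDissipation.Theorems.TaylorWaveQuasiSteady.Negative.TwoHalfD

/-!
# Disproof of `TaylorWaveQuasiSteady` (stmt-AnomalousDissipation-16293) — findings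

Crux disprover work file (seat `refuter-cdisprove-stmt-AnomalousDissipation-16293-0`, cycle 1, 2026-08-17),
extending the refuter-first attack `Cruxes/TaylorWaveQuasiSteady/CRUX-ATTACK-g1.md`.

**STATUS: NO KILL.** The crux — ONE smooth divergence-free mean-zero force `f` on `T³`, `ν_n → 0⁺`,
`E`, `ε₀ > 0`; `∀ K ∃ C_K ∀ n`: smooth divergence-free mean-zero `w`, smooth `q`, drift `|c| ≤ C_K`, with
LIGHT `∫‖w‖² ≤ E`, LOUD `|ν_n‖∇w‖₂² − ε₀| ≤ C_K√ν_n`, QUASI-STEADY `‖(w·∇)w − ν_nΔw + ∇q − c∂₂w − f‖₂² ≤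
C_K ν_n^K` — survives every cheap attack; what is known is NEGATIVE KNOWLEDGE ABOUT ITS WITNESSES, all
kernel-checked and LANDED under `Theorems/TaylorWaveQuasiSteady/Negative/`:

## Index of findings

* §A LOAD-BEARING CLAUSES (any proof must use them):
  - `taylorWaveQuasiSteady_false_without_convect` (LoadBearing, p150654): delete `(w·∇)w` ⇒ FALSE.
    Every witness has `liminf ‖P[(w_n·∇)w_n]‖₂ ≥ ε₀/√E`: no shear / Beltrami / exact-Euler / Oseen family.
  - `taylorWaveQuasiSteady_false_without_force` (LoadBearing): `f = 0` ⇒ FALSE; the work `∫⟪f,w_n⟫ → ε₀`.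
  - `taylorWaveQuasiSteady_false_planar` (Stretching, p158568): THREE-DIMENSIONALITY — witnesses that are
    planar (`w_a ≡ 0`, `∂_a w ≡ 0` for some axis `a = a(K,n)`) ⇒ FALSE already at `K = 1`
    (enstrophy balance + FMRT (A.62): planar fields produce no enstrophy).
* §B TIGHTNESS / NECESSARY CONDITIONS on witnesses:
  - `taylorWaveQuasiSteady_work_ceiling` (WorkCeiling, p158634): `ε₀² ≤ E‖f‖₂²` from the `K = 1` clauses.
  - `stretching_floor` (Stretching): `ν_n ∫⟪(w_n·∇)w_n, Δw_n⟫ ≥ ε₀²/(2E) − o(1)`: enstrophy production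
    `≳ ν_n⁻¹`, i.e. the route's "neutral tuning" balance (wave-enstrophy production by strain = viscous
    loss at the Taylor scale) is not a design choice but forced on EVERY witness.
* §C NATURAL STRENGTHENINGS: planar — refuted (§A); uniform-in-`K` constant — collapses to EXACT steady
  states (`uniformK_residual_integral_eq_zero` below), i.e. to the open steady zeroth law (stmt-0219-type),
  neither refutable here nor needed by the route; 2.5-D (`∂_a w ≡ 0`, three components) — REDUCED and
  half-refuted: `taylorWaveQuasiSteady_false_twoHalfD_quietAxial` (TwoHalfD, p160532, with the calculus of
  `w_h = w − w_a e_a` in HorizontalCalculus, p159689) kills every 2.5-D family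
  whose axial component carries only an `O(√ν_n)` share of the dissipation, via `twoHalfD_horizontal_quiet`
  (= `Negative.horizontal_dissipation_bound`: the horizontal part of an axis-invariant witness is quiet); what
  is left, `taylorWaveQuasiSteady_false_twoHalfD` (all loudness in the passive axial scalar), is a steady-source
  passive-scalar question and stays `sorry`ed with the obstruction in its docstring.
* §D TARGETS: none this cycle (no line picked, no stuck stubs). The registered stubs of `Lines/birth.lean`
  were read against their intended proofs: `stub_residualTransfer` (Galilean absorption of the vertical
  mean is exact; first/second-order chain rule through the smooth phase map) and `stub_taylorDissipationLaw`
  (two-scale chain rule + averaging lemma with rate `1/((n+1)m)`, which genuinely needs its hypothesis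
  `∂₂G = 0`) look TRUE as typed; `stub_profiles` is the crux transferred (no cheap profile-level
  obstruction: at order `ε⁻¹` the two-scale residual only forces `(P − c e₂)·∇S = O(ε)` on the loud set,
  the route's first-integral design).
* §E WHY THE CRUX RESISTS (for provers; constructive reading at the end): the two balance laws (energy:
  `ν‖∇w‖² = ∫⟪f,w⟫ + ∫⟪R,w⟫`;
  enstrophy: `ν‖Δw‖² = ∫⟪(w·∇)w,Δw⟫ − ∫⟪R,Δw⟫ − ∫⟪Δf,w⟫`) are the only coercive a-priori identities of a
  steady quasi-solution, and in 3-D both are CONSISTENT with loud-and-light families (they only produce the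
  necessary conditions of §B). A proof of `¬TaylorWaveQuasiSteady` would be a theorem "fixed-force
  `O(ν^{K/2})`-quasi-steady families with bounded energy dissipate `o(1)`", i.e. a negative answer to the
  quasi-steady form of Bruè–De Lellis 2023, Q2.1/2.2 — open. No catalogued barrier
  (`Literature/Barriers/AnomalousDissipation/`, 17 files) bites the STATEMENT: Alexakis–Doering is planar
  (now formalised as §A-planar for quasi-steady families), De Rosa–Drivas–Inversi constrain only the support
  dimension of the dissipation measure (a space-filling band is admissible), BV/Onsager-type rigidity does
  not apply (`|∇w_n| ≍ ν_n^{-1/2}` in `L²`). The negatives index (6 refuted statements of the summit) has no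
  two-scale / quasi-steady entry. The live attack surface is therefore the LINE, not the crux: the
  strategist's no-go N2 (`STRATEGY-CENSUS.md`: no planar Euler-steady base with first-integral monophase
  phase hosts a neutral band) already moved the construction to `Lines/windfibred.lean`.
  CONSTRUCTIVE READING of §B for a monophase ansatz `w = U + V(x, S/ε)`, `ν = ε²`: the work ceiling is the
  order-`ε⁰` energy bookkeeping `∫⟪f, U⟫ = ε₀` (the mean flow, not the wave, receives the work); the
  stretching floor is the order-`ε⁻²` enstrophy bookkeeping — the nominally `O(ε⁻³)` self-stretching of the
  wave, `ε⁻³|k|²|∂_θV|²(k·∂_θV)`, is only `O(ε⁻²)` by two-scale incompressibility (`k·∂_θV = −ε div_x V`), so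
  the wave enstrophy `∼ ε⁻²|k|²|∂_θV|²` must be produced at rate `O(1)` by the interaction of the wave with
  SLOW gradients (mean strain `∇U`, slow modulation `∇ₓV`): the balance "production by strain = viscous loss
  `|k|²`" that the neutral Lifschitz–Hameiri tuning of the lines encodes, now a proved necessity (in integrated
  form) rather than a design choice.
-/

-- `Summit.<Summit>.<Problem>`: single-conjunct summit, the duplicate namespace component is mandated.
set_option linter.dupNamespace false

noncomputable section

open MeasureTheory Filter Topology
open scoped InnerProductSpace

namespace Summit.AnomalousDissipation.AnomalousDissipation.Cruxes.TaylorWaveQuasiSteady.Disproof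

open Literature.Analysis.FunctionSpaces
open Summit.AnomalousDissipation.AnomalousDissipation.Theses.NeutralTaylorWaves (TaylorWaveQuasiSteady)
open Summit.AnomalousDissipation.AnomalousDissipation.Theorems.TaylorWaveQuasiSteady

/-! ## §A Load-bearing clauses -/

/-- The crux with the Euler nonlinearity `(w·∇)w` DELETED from the residual (linear Oseen–Stokes
quasi-solutions). -/
def TaylorWaveQuasiSteadyWithoutConvect : Prop :=
  ∃ f : UnitAddTorus (Fin 3) → EuclideanSpace ℝ (Fin 3),
    Torus.IsSmooth f ∧ Torus.IsDivFree f ∧ Torus.HasZeroMean f ∧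
    ∃ (ν : ℕ → ℝ) (E ε₀ : ℝ), (∀ n, 0 < ν n) ∧ Filter.Tendsto ν Filter.atTop (nhds 0) ∧ 0 < ε₀ ∧
    ∀ K : ℕ, ∃ C : ℝ, ∀ n : ℕ, ∃ (w : UnitAddTorus (Fin 3) → EuclideanSpace ℝ (Fin 3))
      (q : UnitAddTorus (Fin 3) → ℝ) (c : ℝ),
      Torus.IsSmooth w ∧ Torus.IsSmooth q ∧ Torus.IsDivFree w ∧ Torus.HasZeroMean w ∧ |c| ≤ C ∧
      MeasureTheory.integral MeasureTheory.volume (fun x => ‖w x‖ ^ 2) ≤ E ∧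
      |ν n * Torus.gradNormSq w - ε₀| ≤ C * Real.sqrt (ν n) ∧
      MeasureTheory.integral MeasureTheory.volume (fun x =>
        ‖-((ν n) • Torus.laplacian w x) + Torus.gradient q x
          - c • Torus.partialDeriv (2 : Fin 3) w x - f x‖ ^ 2) ≤ C * (ν n) ^ (K : ℕ)

/-- **The nonlinearity is load-bearing**: `TaylorWaveQuasiSteadyWithoutConvect` is FALSE
(landed: `Negative.taylorWaveQuasiSteady_false_without_convect`, LoadBearing.lean). -/
theorem taylorWaveQuasiSteady_false_without_convect : ¬ TaylorWaveQuasiSteadyWithoutConvect :=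
  Negative.taylorWaveQuasiSteady_false_without_convect

/-- The crux body with the force put to `f = 0`. -/
def TaylorWaveQuasiSteadyWithoutForce : Prop :=
  ∃ (ν : ℕ → ℝ) (E ε₀ : ℝ), (∀ n, 0 < ν n) ∧ Filter.Tendsto ν Filter.atTop (nhds 0) ∧ 0 < ε₀ ∧
    ∀ K : ℕ, ∃ C : ℝ, ∀ n : ℕ, ∃ (w : UnitAddTorus (Fin 3) → EuclideanSpace ℝ (Fin 3))
      (q : UnitAddTorus (Fin 3) → ℝ) (c : ℝ),
      Torus.IsSmooth w ∧ Torus.IsSmooth q ∧ Torus.IsDivFree w ∧ Torus.HasZeroMean w ∧ |c| ≤ C ∧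
      MeasureTheory.integral MeasureTheory.volume (fun x => ‖w x‖ ^ 2) ≤ E ∧
      |ν n * Torus.gradNormSq w - ε₀| ≤ C * Real.sqrt (ν n) ∧
      MeasureTheory.integral MeasureTheory.volume (fun x =>
        ‖Torus.convect w w x - (ν n) • Torus.laplacian w x + Torus.gradient q x
          - c • Torus.partialDeriv (2 : Fin 3) w x‖ ^ 2) ≤ C * (ν n) ^ (K : ℕ)

/-- **The force is load-bearing**: `TaylorWaveQuasiSteadyWithoutForce` is FALSE
(landed: `Negative.taylorWaveQuasiSteady_false_without_force`, LoadBearing.lean). -/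
theorem taylorWaveQuasiSteady_false_without_force : ¬ TaylorWaveQuasiSteadyWithoutForce :=
  Negative.taylorWaveQuasiSteady_false_without_force

/-- The PLANAR strengthening of the crux: the witnesses have, for some axis `a` (free to depend on
`K` and `n`), no component and no variation along `a`. -/
def TaylorWaveQuasiSteadyPlanar : Prop :=
  ∃ f : UnitAddTorus (Fin 3) → EuclideanSpace ℝ (Fin 3),
    Torus.IsSmooth f ∧ Torus.IsDivFree f ∧ Torus.HasZeroMean f ∧
    ∃ (ν : ℕ → ℝ) (E ε₀ : ℝ), (∀ n, 0 < ν n) ∧ Filter.Tendsto ν Filter.atTop (nhds 0) ∧ 0 < ε₀ ∧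
    ∀ K : ℕ, ∃ C : ℝ, ∀ n : ℕ, ∃ (w : UnitAddTorus (Fin 3) → EuclideanSpace ℝ (Fin 3))
      (q : UnitAddTorus (Fin 3) → ℝ) (c : ℝ),
      (∃ a : Fin 3, (∀ x, w x a = 0) ∧ ∀ x, Torus.partialDeriv a w x = 0) ∧
      Torus.IsSmooth w ∧ Torus.IsSmooth q ∧ Torus.IsDivFree w ∧ Torus.HasZeroMean w ∧ |c| ≤ C ∧
      MeasureTheory.integral MeasureTheory.volume (fun x => ‖w x‖ ^ 2) ≤ E ∧
      |ν n * Torus.gradNormSq w - ε₀| ≤ C * Real.sqrt (ν n) ∧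
      MeasureTheory.integral MeasureTheory.volume (fun x =>
        ‖Torus.convect w w x - (ν n) • Torus.laplacian w x + Torus.gradient q x
          - c • Torus.partialDeriv (2 : Fin 3) w x - f x‖ ^ 2) ≤ C * (ν n) ^ (K : ℕ)

/-- The planar statement IS a strengthening of the crux (drop the extra clause). -/
theorem taylorWaveQuasiSteady_of_planar : TaylorWaveQuasiSteadyPlanar → TaylorWaveQuasiSteady := by
  rintro ⟨f, hf, hfd, hfm, ν, E, ε₀, hν, hν0, hε₀, hK⟩
  refine ⟨f, hf, hfd, hfm, ν, E, ε₀, hν, hν0, hε₀, fun K => ?_⟩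
  obtain ⟨C, hC⟩ := hK K
  refine ⟨C, fun n => ?_⟩
  obtain ⟨w, q, c, -, hw, hq, hdiv, hmean, hc, hE, hD, hR⟩ := hC n
  exact ⟨w, q, c, hw, hq, hdiv, hmean, hc, hE, hD, hR⟩

/-- **Three-dimensionality is load-bearing**: `TaylorWaveQuasiSteadyPlanar` is FALSE (already its order
`K = 1`; landed: `Negative.taylorWaveQuasiSteady_false_planar`, Stretching.lean, p158568). -/
theorem taylorWaveQuasiSteady_false_planar : ¬ TaylorWaveQuasiSteadyPlanar :=
  Negative.taylorWaveQuasiSteady_false_planar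

/-! ## §B Tightness: necessary conditions on every witness -/

/-- **Work ceiling**: the `K = 1` level of the crux forces `ε₀² ≤ E · ‖f‖₂²` (landed:
`Negative.taylorWaveQuasiSteady_work_ceiling`, WorkCeiling.lean, p158634). Consequently
`TaylorWaveQuasiSteady` can only hold with `E ≥ ε₀²/‖f‖₂²`. -/
theorem work_ceiling (f : UnitAddTorus (Fin 3) → EuclideanSpace ℝ (Fin 3)) (hf : Torus.IsSmooth f)
    (ν : ℕ → ℝ) (E ε₀ : ℝ) (hν : ∀ n, 0 < ν n) (hν0 : Filter.Tendsto ν Filter.atTop (nhds 0))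
    (hε₀ : 0 < ε₀)
    (h1 : ∃ C : ℝ, ∀ n : ℕ, ∃ (w : UnitAddTorus (Fin 3) → EuclideanSpace ℝ (Fin 3))
        (q : UnitAddTorus (Fin 3) → ℝ) (c : ℝ),
        Torus.IsSmooth w ∧ Torus.IsSmooth q ∧ Torus.IsDivFree w ∧ Torus.HasZeroMean w ∧ |c| ≤ C ∧
        MeasureTheory.integral MeasureTheory.volume (fun x => ‖w x‖ ^ 2) ≤ E ∧
        |ν n * Torus.gradNormSq w - ε₀| ≤ C * Real.sqrt (ν n) ∧
        MeasureTheory.integral MeasureTheory.volume (fun x =>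
          ‖Torus.convect w w x - (ν n) • Torus.laplacian w x + Torus.gradient q x
            - c • Torus.partialDeriv (2 : Fin 3) w x - f x‖ ^ 2) ≤ C * (ν n) ^ (1 : ℕ)) :
    ε₀ ^ 2 ≤ E * ∫ x, ‖f x‖ ^ 2 :=
  Negative.taylorWaveQuasiSteady_work_ceiling f hf ν E ε₀ hν hν0 hε₀ h1

/-- **Stretching floor** (landed: `Negative.stretching_floor`, Stretching.lean): for one witness field,
`ε²/E ≤ ‖R‖₂² + ν‖Δf‖₂² + νE + 2ν∫⟪(w·∇)w, Δw⟫` whenever `ε ≤ ν‖∇w‖₂²`, `∫‖w‖² ≤ E`. Along a witness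
family: `ν_n∫⟪(w_n·∇)w_n, Δw_n⟫ ≥ ε₀²/(2E) − o(1)`. -/
theorem stretching_floor {w f : UnitAddTorus (Fin 3) → EuclideanSpace ℝ (Fin 3)}
    {q : UnitAddTorus (Fin 3) → ℝ} (hw : Torus.IsSmooth w) (hq : Torus.IsSmooth q)
    (hf : Torus.IsSmooth f) (hdiv : Torus.IsDivFree w) {ν : ℝ} (hν : 0 ≤ ν) (c : ℝ) {E ε : ℝ}
    (hE : 0 < E) (hε : 0 ≤ ε) (hwE : ∫ x, ‖w x‖ ^ 2 ≤ E) (hεw : ε ≤ ν * Torus.gradNormSq w) :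
    ε ^ 2 / E ≤
      (∫ x, ‖Torus.convect w w x - ν • Torus.laplacian w x + Torus.gradient q x
          - c • Torus.partialDeriv (2 : Fin 3) w x - f x‖ ^ 2)
        + ν * (∫ x, ‖Torus.laplacian f x‖ ^ 2) + ν * E
        + 2 * ν * ∫ x, ⟪Torus.convect w w x, Torus.laplacian w x⟫_ℝ :=
  Negative.stretching_floor hw hq hf hdiv hν c (2 : Fin 3) hE hε hwE hεw

/-! ## §C Natural strengthenings -/

/-- The UNIFORM-IN-`K` strengthening (`∃ C ∀ K ∀ n` instead of `∀ K ∃ C ∀ n`). -/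
def TaylorWaveQuasiSteadyUniformK : Prop :=
  ∃ f : UnitAddTorus (Fin 3) → EuclideanSpace ℝ (Fin 3),
    Torus.IsSmooth f ∧ Torus.IsDivFree f ∧ Torus.HasZeroMean f ∧
    ∃ (ν : ℕ → ℝ) (E ε₀ : ℝ), (∀ n, 0 < ν n) ∧ Filter.Tendsto ν Filter.atTop (nhds 0) ∧ 0 < ε₀ ∧
    ∃ C : ℝ, ∀ K : ℕ, ∀ n : ℕ, ∃ (w : UnitAddTorus (Fin 3) → EuclideanSpace ℝ (Fin 3))
      (q : UnitAddTorus (Fin 3) → ℝ) (c : ℝ),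
      Torus.IsSmooth w ∧ Torus.IsSmooth q ∧ Torus.IsDivFree w ∧ Torus.HasZeroMean w ∧ |c| ≤ C ∧
      MeasureTheory.integral MeasureTheory.volume (fun x => ‖w x‖ ^ 2) ≤ E ∧
      |ν n * Torus.gradNormSq w - ε₀| ≤ C * Real.sqrt (ν n) ∧
      MeasureTheory.integral MeasureTheory.volume (fun x =>
        ‖Torus.convect w w x - (ν n) • Torus.laplacian w x + Torus.gradient q x
          - c • Torus.partialDeriv (2 : Fin 3) w x - f x‖ ^ 2) ≤ C * (ν n) ^ (K : ℕ)

/-- A nonnegative real below `C ν^K` for every `K`, with `0 < ν < 1`, is zero. [folklore] -/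
theorem eq_zero_of_forall_le_mul_pow {r C ν : ℝ} (hr : 0 ≤ r) (hν : 0 < ν) (hν1 : ν < 1)
    (h : ∀ K : ℕ, r ≤ C * ν ^ K) : r = 0 := by
  have ht : Tendsto (fun K : ℕ => C * ν ^ K) atTop (nhds (C * 0)) :=
    (tendsto_pow_atTop_nhds_zero_of_lt_one hν.le hν1).const_mul C
  rw [mul_zero] at ht
  have : r ≤ 0 := ge_of_tendsto' ht fun K => h K
  exact le_antisymm this hr

/-- **The uniform-in-`K` strengthening is an EXACT-steady-state statement**: as soon as `ν_n < 1`, a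
field that serves all orders `K` with the same constant has residual `∫‖R‖² = 0`, i.e. (the integrand
being continuous) `w − c e₂` is an exact smooth steady state of `NS_{ν_n}(f)` with energy `≤ 2E + 2C²`
and dissipation `→ ε₀`: this is the steady zeroth law itself (stmt-0219-type, OPEN), so this
strengthening is neither refutable here nor what the route needs (Newton realisation wants finite `K`).
Formalised: the vanishing of the residual integral. -/
theorem uniformK_residual_integral_eq_zero
    {f w : UnitAddTorus (Fin 3) → EuclideanSpace ℝ (Fin 3)} {q : UnitAddTorus (Fin 3) → ℝ}
    {ν c C : ℝ} (hν : 0 < ν) (hν1 : ν < 1)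
    (h : ∀ K : ℕ, MeasureTheory.integral MeasureTheory.volume (fun x =>
        ‖Torus.convect w w x - ν • Torus.laplacian w x + Torus.gradient q x
          - c • Torus.partialDeriv (2 : Fin 3) w x - f x‖ ^ 2) ≤ C * ν ^ (K : ℕ)) :
    MeasureTheory.integral MeasureTheory.volume (fun x =>
        ‖Torus.convect w w x - ν • Torus.laplacian w x + Torus.gradient q x
          - c • Torus.partialDeriv (2 : Fin 3) w x - f x‖ ^ 2) = 0 :=
  eq_zero_of_forall_le_mul_pow (integral_nonneg fun x => by positivity) hν hν1 h

/-- The TWO-AND-A-HALF-DIMENSIONAL strengthening: witnesses invariant along some axis `a` (`∂_a w ≡ 0`)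
but with all three components (the component `w_a` is then a passive scalar carried by the planar part). -/
def TaylorWaveQuasiSteadyTwoHalfD : Prop :=
  ∃ f : UnitAddTorus (Fin 3) → EuclideanSpace ℝ (Fin 3),
    Torus.IsSmooth f ∧ Torus.IsDivFree f ∧ Torus.HasZeroMean f ∧
    ∃ (ν : ℕ → ℝ) (E ε₀ : ℝ), (∀ n, 0 < ν n) ∧ Filter.Tendsto ν Filter.atTop (nhds 0) ∧ 0 < ε₀ ∧
    ∀ K : ℕ, ∃ C : ℝ, ∀ n : ℕ, ∃ (w : UnitAddTorus (Fin 3) → EuclideanSpace ℝ (Fin 3))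
      (q : UnitAddTorus (Fin 3) → ℝ) (c : ℝ),
      (∃ a : Fin 3, ∀ x, Torus.partialDeriv a w x = 0) ∧
      Torus.IsSmooth w ∧ Torus.IsSmooth q ∧ Torus.IsDivFree w ∧ Torus.HasZeroMean w ∧ |c| ≤ C ∧
      MeasureTheory.integral MeasureTheory.volume (fun x => ‖w x‖ ^ 2) ≤ E ∧
      |ν n * Torus.gradNormSq w - ε₀| ≤ C * Real.sqrt (ν n) ∧
      MeasureTheory.integral MeasureTheory.volume (fun x =>
        ‖Torus.convect w w x - (ν n) • Torus.laplacian w x + Torus.gradient q x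
          - c • Torus.partialDeriv (2 : Fin 3) w x - f x‖ ^ 2) ≤ C * (ν n) ^ (K : ℕ)

/-- **NEAR-MISS (not closed): the 2.5-D strengthening.** Expected FALSE but NOT proved. What IS proved
(`twoHalfD_horizontal_quiet`, `taylorWaveQuasiSteady_false_twoHalfD_quietAxial` below, both LANDED in
`Negative/TwoHalfD.lean`): the horizontal part `w_h = w − w_a e_a` of an `a`-invariant witness obeys
`ν_n‖∇w_h‖₂² = O(√ν_n)`, so all the anomalous dissipation must sit in the passive component `θ = w_a`,
which solves the steady
advection–diffusion problem `w_h·∇θ − ν_nΔθ = f_a + R_a` with `‖θ‖₂² ≤ E`. Obstruction: with STIRRING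
allowed to depend on `n` (only `ν_n‖∇w_h‖² → 0` is known, `‖∇w_h‖₂` may still blow up like `ν_n^{-1/4}`),
no a-priori bound forces `ν_n‖∇θ_n‖² → 0` — this is the open question of anomalous dissipation for
steady-source passive scalars in rough-in-the-limit planar flows (for a FIXED smooth cellular stirring the
Childress/Shraiman–Freidlin–Wentzell boundary-layer theory gives dissipation `O(√ν)` when the streamline
averages of `f_a` vanish and `‖θ‖₂ → ∞` otherwise, but uniformity in `n`-dependent stirring is exactly
what is missing). Tried: (i) enstrophy balance for `θ` — production `−∫∇θ·S_h∇θ` has no sign;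
(ii) `H^{-1}` duality `ν‖∇θ‖² = ⟨f_a, θ⟩ ≤ ‖f_a‖_{Ḣ¹}‖θ‖_{Ḣ^{-1}}` — needs `‖θ_n‖_{Ḣ^{-1}} → 0` (mixing),
not implied. Left for a later cycle / a compute probe (cellular stirring at amplitude `ν^{-1/4}`). -/
theorem taylorWaveQuasiSteady_false_twoHalfD : ¬ TaylorWaveQuasiSteadyTwoHalfD := by
  sorry

/-- **Reduction (LANDED as `Negative.horizontal_dissipation_bound`, TwoHalfD.lean): in an `a`-invariant
witness the HORIZONTAL part is quiet.** For smooth divergence-free `w` with `∂_a w ≡ 0` and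
`w_h := w − w_a e_a`: `2s·ν‖∇w_h‖₂² ≤ ‖R‖₂² + ν‖Δf‖₂² + (ν + s²)‖w‖₂²` for the FULL residual `R` of `w`
(any `q`, `c`, `f`), so along a 2.5-D witness family `ν_n‖∇w_h‖² = O(√ν_n)` and the LOUD clause must be
carried by the passive axial component. Mechanism: the planar residual `R'` of `w_h` differs from `R` by a
multiple of `e_a` while `(Δw_h)_a = 0`, so `⟪R', Δw_h⟫ = ⟪R, Δw_h⟫` pointwise; then the enstrophy balance
for the planar field `w_h` (no stretching). -/
theorem twoHalfD_horizontal_quiet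
    {w f : UnitAddTorus (Fin 3) → EuclideanSpace ℝ (Fin 3)} {q : UnitAddTorus (Fin 3) → ℝ}
    (hw : Torus.IsSmooth w) (hq : Torus.IsSmooth q) (hf : Torus.IsSmooth f) (hdiv : Torus.IsDivFree w)
    {a : Fin 3} (hinv : ∀ x, Torus.partialDeriv a w x = 0) {ν : ℝ} (hν : 0 ≤ ν) (c : ℝ) {s : ℝ}
    (hs : 0 ≤ s) :
    2 * s * (ν * Torus.gradNormSq (fun x => w x - (w x a) • EuclideanSpace.single a (1 : ℝ))) ≤
      (∫ x, ‖Torus.convect w w x - ν • Torus.laplacian w x + Torus.gradient q x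
          - c • Torus.partialDeriv (2 : Fin 3) w x - f x‖ ^ 2)
        + ν * (∫ x, ‖Torus.laplacian f x‖ ^ 2) + ν * (∫ x, ‖w x‖ ^ 2)
        + s ^ 2 * (∫ x, ‖w x‖ ^ 2) :=
  Negative.horizontal_dissipation_bound hw hq hf hdiv hinv hν c (2 : Fin 3) hs

/-- The 2.5-D strengthening WITH A QUIET AXIAL COMPONENT: witnesses invariant along some axis `a` whose
axial component carries only an `O(√ν_n)` share of the dissipation,
`ν_n(‖∇w‖₂² − ‖∇w_h‖₂²) = ν_n‖∇w_a‖₂² ≤ C√ν_n`. -/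
def TaylorWaveQuasiSteadyTwoHalfDQuietAxial : Prop :=
  ∃ f : UnitAddTorus (Fin 3) → EuclideanSpace ℝ (Fin 3),
    Torus.IsSmooth f ∧ Torus.IsDivFree f ∧ Torus.HasZeroMean f ∧
    ∃ (ν : ℕ → ℝ) (E ε₀ : ℝ), (∀ n, 0 < ν n) ∧ Filter.Tendsto ν Filter.atTop (nhds 0) ∧ 0 < ε₀ ∧
    ∀ K : ℕ, ∃ C : ℝ, ∀ n : ℕ, ∃ (w : UnitAddTorus (Fin 3) → EuclideanSpace ℝ (Fin 3))
      (q : UnitAddTorus (Fin 3) → ℝ) (c : ℝ),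
      (∃ a : Fin 3, (∀ x, Torus.partialDeriv a w x = 0) ∧
        ν n * Torus.gradNormSq w
          - ν n * Torus.gradNormSq (fun y => w y - (w y a) • EuclideanSpace.single a (1 : ℝ))
          ≤ C * Real.sqrt (ν n)) ∧
      Torus.IsSmooth w ∧ Torus.IsSmooth q ∧ Torus.IsDivFree w ∧ Torus.HasZeroMean w ∧ |c| ≤ C ∧
      MeasureTheory.integral MeasureTheory.volume (fun x => ‖w x‖ ^ 2) ≤ E ∧
      |ν n * Torus.gradNormSq w - ε₀| ≤ C * Real.sqrt (ν n) ∧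
      MeasureTheory.integral MeasureTheory.volume (fun x =>
        ‖Torus.convect w w x - (ν n) • Torus.laplacian w x + Torus.gradient q x
          - c • Torus.partialDeriv (2 : Fin 3) w x - f x‖ ^ 2) ≤ C * (ν n) ^ (K : ℕ)

/-- **All loudness of a 2.5-D witness sits in its passive axial component**:
`TaylorWaveQuasiSteadyTwoHalfDQuietAxial` is FALSE (already its order `K = 1`; LANDED:
`Negative.taylorWaveQuasiSteady_false_twoHalfD_quietAxial`, TwoHalfD.lean). -/
theorem taylorWaveQuasiSteady_false_twoHalfD_quietAxial : ¬ TaylorWaveQuasiSteadyTwoHalfDQuietAxial :=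
  Negative.taylorWaveQuasiSteady_false_twoHalfD_quietAxial

/-! ## §D Targets

No picked line and no stuck stubs this cycle (`payload.targets = []`). Stub reading of `Lines/birth.lean`
(registered, not picked): see the module docstring, item §D. Nothing to refute. -/

/-! ## §E Consistency checks used above (documentation)

* Energy identity `∫⟪R, w⟫ = ν‖∇w‖² − ∫⟪f, w⟫` — `Negative.integral_inner_residual_self`.
* Enstrophy bound with stretching — `Negative.dissipation_bound_with_stretching`.
* Planar vanishing of the cubic density on `T³` — `Negative.sum_apply_mul_inner_eq_zero_of_planar`
  (`fin_cases` on the axis; `tr M·(|M|² − det M)` for the `2×2` block).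
All three hold for ANY drift `c` and ANY axis of planarity, so the drift clause `|c| ≤ C_K` plays no role on
the obstruction side (information for the planner: the drift is there for the realisation step only). -/

end Summit.AnomalousDissipation.AnomalousDissipation.Cruxes.TaylorWaveQuasiSteady.Disproof

end
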